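import Mathlib
import Summits.Ventures.PercRepro2.MergedUnionDefs
import Summits.Ventures.PercRepro2.MergedUnionChain

/-!
# Positive association of the merged clusters under the union conditioning
(blind cell PercRepro2, mine-1 g34)

**Theorem** (`merged_union_pa`). Let `s ≠ t`, `X, Y ⊆ V` with `t ∉ Y`, every edge at `t` of weight
`< 1`, and let `U = {s ↮ X} ∪ {t ↮ Y}`, `Q = {s ↮ t} ∩ U`.  For the merged clusters
`S* = C_s ∪ (C_Y if s ↔ X)` and `T* = C_t ∪ (C_X if t ↔ Y)` and nonnegative bounded functionals
`F, G` increasing in `S*` and decreasing in `T*`,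

  `E[F(S*,T*) 1_Q] · E[G(S*,T*) 1_Q] ≤ E[(F G)(S*,T*) 1_Q] · P(Q)`:

conditionally on `s ↮ t` and the union event, the pair `(S*, V ∖ T*)` is positively associated.
On `{s ↮ X} ∩ {t ↮ Y}` the merged clusters are the plain clusters; on the hit events they absorb
the clusters of the other side's set — this is the forward/backward cluster pair of the mixed
graph `G + (X → z → Y)` conditioned on `s ↛ t`, i.e. BHK06 Theorem 1.5 read in that graph.

**Proof** (BHK06 §2, Gibbs chain with product fibres; no four-function induction).  The chain
`MergedUnionChain.lean` preserves positive association (`iter_mul_ge`), contracts at rate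
`1 − δ`, `δ = P(all edges at t closed) > 0` (`iter_sub_abs_le`), and leaves the law of `S*` under
`P(· | Q)` invariant (`expect_iter_mul_indicator`).  Hence the `S*`-marginal of the conditioned
law is positively associated (`merged_marginal_pa`, an Archimedean limit), and the tower identity
`expect_merged_mul_indicator` with Harris' inequality in the fibre `G ∖ S*` lifts this to the pair.
-/

namespace Summit.Ventures.PercRepro2

namespace MergedU

section Limit

variable {R : Type*} [Field R] [LinearOrder R] [IsStrictOrderedRing R] [Archimedean R]

/-- If `x ≥ -(C q^n)` for every `n`, with `0 ≤ C` and `0 ≤ q < 1`, then `x ≥ 0`. -/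
lemma nonneg_of_forall_neg_mul_pow_le {x C q : R} (hC : 0 ≤ C) (hq1 : q < 1)
    (h : ∀ n : ℕ, -(C * q ^ n) ≤ x) : 0 ≤ x := by
  by_contra hx
  rw [not_le] at hx
  rcases hC.lt_or_eq with hC | hC
  · obtain ⟨n, hn⟩ := exists_pow_lt_of_lt_one (div_pos (neg_pos.2 hx) hC) hq1
    rw [lt_div_iff₀ hC] at hn
    have := h n
    linarith
  · have := h 0
    rw [← hC] at this
    simp at this
    linarith

omit [Archimedean R] in
/-- The arithmetic of the limit step: from the contraction bounds on `A, B, C` and `a b ≤ c`,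
`C Z − A B ≥ −10 M² Z² q^n`. -/
lemma arith_step {A B C Z a b c M qn : R} (hZ0 : 0 ≤ Z) (hM : 0 ≤ M) (hqn0 : 0 ≤ qn) (hqn1 : qn ≤ 1)
    (ha0 : 0 ≤ a) (haM : a ≤ M) (hbM : b ≤ M) (hab : a * b ≤ c)
    (hB0 : 0 ≤ B) (hA : A ≤ a * Z + 2 * M * qn * Z) (hB : B ≤ b * Z + 2 * M * qn * Z)
    (hC : c * Z - 2 * (M * M) * qn * Z ≤ C) :
    -(10 * (M * M) * (Z * Z) * qn) ≤ C * Z - A * B := by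
  have hZZ : 0 ≤ Z * Z := mul_nonneg hZ0 hZ0
  have hMM : 0 ≤ M * M := mul_nonneg hM hM
  have h2M : 0 ≤ 2 * M * qn := by positivity
  have hAB : A * B ≤ (a * Z + 2 * M * qn * Z) * (b * Z + 2 * M * qn * Z) := by
    apply mul_le_mul hA hB hB0
    positivity
  have e1 : (a * Z + 2 * M * qn * Z) * (b * Z + 2 * M * qn * Z) =
      Z * Z * (a * b) + Z * Z * (2 * M * qn * (a + b)) + Z * Z * (4 * (M * M) * (qn * qn)) := by
    ring
  have hab2 : a + b ≤ 2 * M := by linarith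
  have h2a : 2 * M * qn * (a + b) ≤ 2 * M * qn * (2 * M) := mul_le_mul_of_nonneg_left hab2 h2M
  have e2 : 2 * M * qn * (2 * M) = 4 * (M * M) * qn := by ring
  have h2 : Z * Z * (2 * M * qn * (a + b)) ≤ Z * Z * (4 * (M * M) * qn) :=
    mul_le_mul_of_nonneg_left (by linarith) hZZ
  have hqn2 : qn * qn ≤ qn := by
    have := mul_le_mul_of_nonneg_left hqn1 hqn0
    simpa using this
  have h3 : Z * Z * (4 * (M * M) * (qn * qn)) ≤ Z * Z * (4 * (M * M) * qn) :=
    mul_le_mul_of_nonneg_left (mul_le_mul_of_nonneg_left hqn2 (by positivity)) hZZ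
  have h4 : Z * Z * (a * b) ≤ Z * Z * c := mul_le_mul_of_nonneg_left hab hZZ
  have h5 : (c * Z - 2 * (M * M) * qn * Z) * Z ≤ C * Z := mul_le_mul_of_nonneg_right hC hZ0
  have e5 : (c * Z - 2 * (M * M) * qn * Z) * Z = Z * Z * c - 2 * (M * M) * (Z * Z) * qn := by ring
  have e6 : Z * Z * (4 * (M * M) * qn) = 4 * (M * M) * (Z * Z) * qn := by ring
  linarith

end Limit

section Main

variable {V : Type*} {E : Type*} [Fintype E] [DecidableEq E] [Fintype V] [DecidableEq V]
  {R : Type*} [Field R] [LinearOrder R] [IsStrictOrderedRing R] [Archimedean R]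
  {p : E → R} (ends : E → Sym2 V) (s t : V) (X Y : Set V)

omit [Fintype V] [DecidableEq V] [Archimedean R] in
/-- The `n`-step functional evaluated on `S*` under `P(· | Q)` is within `2 M (1 − δ)^n` of its
value from the fixed start `W₀` (coalescence). -/
lemma expect_iter_sub_abs_le (hp : IsProbVec p) (htY : t ∉ Y) {F : Set V → R} {M : R}
    (hF : ∀ W, |F W| ≤ M) (n : ℕ) (W₀ : Set V) :
    |expect p (fun ω => iter p ends s t X Y n F (merged ends ω s X Y) *
        ({ω : Config E | t ∉ merged ends ω s X Y}).indicator 1 ω) -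
      iter p ends s t X Y n F W₀ * prob p {ω : Config E | t ∉ merged ends ω s X Y}| ≤
      2 * M * (1 - prob p (allClosed (tEdges ends t))) ^ n *
        prob p {ω : Config E | t ∉ merged ends ω s X Y} := by
  set Q : Set (Config E) := {ω : Config E | t ∉ merged ends ω s X Y} with hQ
  set q := 1 - prob p (allClosed (tEdges ends t)) with hq
  have e : expect p (fun ω => iter p ends s t X Y n F (merged ends ω s X Y) * Q.indicator 1 ω) -
      iter p ends s t X Y n F W₀ * prob p Q =
      expect p (fun ω => (iter p ends s t X Y n F (merged ends ω s X Y) -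
        iter p ends s t X Y n F W₀) * Q.indicator 1 ω) := by
    rw [prob_eq_expect_indicator, ← expect_const_mul, ← expect_sub]
    congr 1
    funext ω
    simp only [Pi.sub_apply]
    ring
  rw [e]
  refine (abs_expect_le hp _).trans ?_
  have hpt : ∀ ω, |(iter p ends s t X Y n F (merged ends ω s X Y) -
      iter p ends s t X Y n F W₀) * Q.indicator (1 : Config E → R) ω| ≤
      2 * M * q ^ n * Q.indicator 1 ω := by
    intro ω
    rw [abs_mul, abs_of_nonneg (show (0 : R) ≤ Q.indicator 1 ω from
      Set.indicator_apply_nonneg fun _ => zero_le_one)]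
    exact mul_le_mul_of_nonneg_right (iter_sub_abs_le ends s t X Y hp htY hF n _ _)
      (Set.indicator_apply_nonneg fun _ => zero_le_one)
  refine (expect_mono hp hpt).trans ?_
  rw [expect_const_mul, ← prob_eq_expect_indicator]

omit [DecidableEq V] in
/-- **Positive association of the `S*`-marginal of the union-conditioned law**: for monotone
`F, G` with `0 ≤ F, G ≤ M`, `E[F(S*) 1_Q] · E[G(S*) 1_Q] ≤ E[(F G)(S*) 1_Q] · P(Q)`. -/
theorem merged_marginal_pa (hp : IsProbVec p) (htY : t ∉ Y)
    (hδ : 0 < prob p (allClosed (tEdges ends t))) {F G : Set V → R} (hF : Monotone F)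
    (hG : Monotone G) {M : R} (hF0 : ∀ W, 0 ≤ F W) (hG0 : ∀ W, 0 ≤ G W) (hFM : ∀ W, F W ≤ M)
    (hGM : ∀ W, G W ≤ M) :
    expect p (fun ω => F (merged ends ω s X Y) *
        ({ω : Config E | t ∉ merged ends ω s X Y}).indicator 1 ω) *
      expect p (fun ω => G (merged ends ω s X Y) *
        ({ω : Config E | t ∉ merged ends ω s X Y}).indicator 1 ω) ≤
    expect p (fun ω => F (merged ends ω s X Y) * G (merged ends ω s X Y) *
        ({ω : Config E | t ∉ merged ends ω s X Y}).indicator 1 ω) *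
      prob p {ω : Config E | t ∉ merged ends ω s X Y} := by
  have hM : 0 ≤ M := (hF0 ∅).trans (hFM ∅)
  have hZ0 : 0 ≤ prob p {ω : Config E | t ∉ merged ends ω s X Y} := prob_nonneg hp _
  have hq0 : 0 ≤ 1 - prob p (allClosed (tEdges ends t)) := by
    have := prob_le_one hp (allClosed (tEdges ends t))
    linarith
  have hq1 : 1 - prob p (allClosed (tEdges ends t)) < 1 := by linarith
  have hFabs : ∀ W, |F W| ≤ M := fun W => by rw [abs_of_nonneg (hF0 W)]; exact hFM W
  have hGabs : ∀ W, |G W| ≤ M := fun W => by rw [abs_of_nonneg (hG0 W)]; exact hGM W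
  have hFGabs : ∀ W, |F W * G W| ≤ M * M := fun W => by
    rw [abs_of_nonneg (mul_nonneg (hF0 W) (hG0 W))]
    exact mul_le_mul (hFM W) (hGM W) (hG0 W) hM
  have hA0 : 0 ≤ expect p (fun ω => F (merged ends ω s X Y) *
      ({ω : Config E | t ∉ merged ends ω s X Y}).indicator 1 ω) :=
    expect_nonneg hp fun ω => mul_nonneg (hF0 _) (Set.indicator_apply_nonneg fun _ => zero_le_one)
  have hB0 : 0 ≤ expect p (fun ω => G (merged ends ω s X Y) *
      ({ω : Config E | t ∉ merged ends ω s X Y}).indicator 1 ω) :=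
    expect_nonneg hp fun ω => mul_nonneg (hG0 _) (Set.indicator_apply_nonneg fun _ => zero_le_one)
  -- the bound for every `n`
  have key : ∀ n : ℕ, -(10 * (M * M) *
      (prob p {ω : Config E | t ∉ merged ends ω s X Y} *
        prob p {ω : Config E | t ∉ merged ends ω s X Y}) *
      (1 - prob p (allClosed (tEdges ends t))) ^ n) ≤
      expect p (fun ω => F (merged ends ω s X Y) * G (merged ends ω s X Y) *
          ({ω : Config E | t ∉ merged ends ω s X Y}).indicator 1 ω) *
        prob p {ω : Config E | t ∉ merged ends ω s X Y} -
      expect p (fun ω => F (merged ends ω s X Y) *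
          ({ω : Config E | t ∉ merged ends ω s X Y}).indicator 1 ω) *
        expect p (fun ω => G (merged ends ω s X Y) *
          ({ω : Config E | t ∉ merged ends ω s X Y}).indicator 1 ω) := by
    intro n
    have hab : iter p ends s t X Y n F ∅ * iter p ends s t X Y n G ∅ ≤
        iter p ends s t X Y n (fun W => F W * G W) ∅ := iter_mul_ge ends s t X Y hp hF hG n ∅
    have ha0 : 0 ≤ iter p ends s t X Y n F ∅ := le_iter ends s t X Y hp hF0 n ∅
    have hb0 : 0 ≤ iter p ends s t X Y n G ∅ := le_iter ends s t X Y hp hG0 n ∅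
    have haM : iter p ends s t X Y n F ∅ ≤ M := iter_le ends s t X Y hp hFM n ∅
    have hbM : iter p ends s t X Y n G ∅ ≤ M := iter_le ends s t X Y hp hGM n ∅
    have hqn0 : 0 ≤ (1 - prob p (allClosed (tEdges ends t))) ^ n := pow_nonneg hq0 n
    have hqn1 : (1 - prob p (allClosed (tEdges ends t))) ^ n ≤ 1 := pow_le_one₀ hq0 hq1.le
    -- stationarity + contraction
    have hA' := expect_iter_sub_abs_le ends s t X Y hp htY hFabs n ∅
    have hB' := expect_iter_sub_abs_le ends s t X Y hp htY hGabs n ∅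
    have hC' := expect_iter_sub_abs_le ends s t X Y hp htY hFGabs n ∅
    rw [expect_iter_mul_indicator, abs_le] at hA' hB' hC'
    exact arith_step hZ0 hM hqn0 hqn1 ha0 haM hbM hab hB0 (by linarith [hA'.2])
      (by linarith [hB'.2]) (by linarith [hC'.1])
  have := nonneg_of_forall_neg_mul_pow_le (by positivity) hq1 key
  linarith

omit [Fintype V] [DecidableEq V] [Archimedean R] in
/-- `F̂(W) = E[F(W, T*) in G ∖ W]` is monotone in `W` for `F` increasing in the first and decreasing
in the second argument. -/
lemma fibreExpect_mono (hp : IsProbVec p) {F : Set V → Set V → R}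
    (hF : ∀ ⦃W W' C C' : Set V⦄, W ⊆ W' → C' ⊆ C → F W C ≤ F W' C') :
    Monotone (fun W => expect p (fun ω' => F W (merged ends (delConfig ends W ω') t Y X))) := by
  intro W W' h
  refine expect_mono hp fun ω' => hF h ?_
  exact merged_mono (delConfig_anti h ω') t Y X

omit [Fintype V] [DecidableEq V] [Archimedean R] in
/-- **Harris in the fibre `G ∖ W`**: `F̂(W) Ĝ(W) ≤ (F G)^(W)`. -/
lemma fibreExpect_mul_le (hp : IsProbVec p) {F G : Set V → Set V → R}
    (hF : ∀ ⦃W W' C C' : Set V⦄, W ⊆ W' → C' ⊆ C → F W C ≤ F W' C')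
    (hG : ∀ ⦃W W' C C' : Set V⦄, W ⊆ W' → C' ⊆ C → G W C ≤ G W' C') (W : Set V) :
    expect p (fun ω' => F W (merged ends (delConfig ends W ω') t Y X)) *
        expect p (fun ω' => G W (merged ends (delConfig ends W ω') t Y X)) ≤
      expect p (fun ω' => F W (merged ends (delConfig ends W ω') t Y X) *
        G W (merged ends (delConfig ends W ω') t Y X)) := by
  apply expect_mul_expect_le_expect_mul_anti hp
  · intro ω₁ ω₂ h
    exact hF (subset_refl W) (merged_mono (delConfig_mono_config W h) t Y X)
  · intro ω₁ ω₂ h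
    exact hG (subset_refl W) (merged_mono (delConfig_mono_config W h) t Y X)

omit [DecidableEq V] in
/-- **Positive association of the merged clusters under the union conditioning.**  With
`S* = merged ω s X Y = C_s ∪ (C_Y if s ↔ X)`, `T* = merged ω t Y X = C_t ∪ (C_X if t ↔ Y)` and
`Q = {t ∉ S*} = {s ↮ t} ∩ ({s ↮ X} ∪ {t ↮ Y})`, for `F, G` increasing in `S*`, decreasing in `T*`,
with `0 ≤ F, G ≤ M`, and every edge at `t` of weight `< 1`, `t ∉ Y`:
`E[F(S*,T*) 1_Q] · E[G(S*,T*) 1_Q] ≤ E[(F G)(S*,T*) 1_Q] · P(Q)`. -/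
theorem merged_union_pa (hp : IsProbVec p) (htY : t ∉ Y)
    (hpt : ∀ e ∈ touches ends {t}, p e < 1) {F G : Set V → Set V → R}
    (hF : ∀ ⦃W W' C C' : Set V⦄, W ⊆ W' → C' ⊆ C → F W C ≤ F W' C')
    (hG : ∀ ⦃W W' C C' : Set V⦄, W ⊆ W' → C' ⊆ C → G W C ≤ G W' C')
    (hF0 : ∀ W C, 0 ≤ F W C) (hG0 : ∀ W C, 0 ≤ G W C) {M : R} (hFM : ∀ W C, F W C ≤ M)
    (hGM : ∀ W C, G W C ≤ M) :
    expect p (fun ω => F (merged ends ω s X Y) (merged ends ω t Y X) *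
        ({ω : Config E | t ∉ merged ends ω s X Y}).indicator 1 ω) *
      expect p (fun ω => G (merged ends ω s X Y) (merged ends ω t Y X) *
        ({ω : Config E | t ∉ merged ends ω s X Y}).indicator 1 ω) ≤
    expect p (fun ω => F (merged ends ω s X Y) (merged ends ω t Y X) *
        G (merged ends ω s X Y) (merged ends ω t Y X) *
        ({ω : Config E | t ∉ merged ends ω s X Y}).indicator 1 ω) *
      prob p {ω : Config E | t ∉ merged ends ω s X Y} := by
  -- `δ > 0`
  have hδ : 0 < prob p (allClosed (tEdges ends t)) := by
    rw [prob_allClosed_tEdges]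
    apply Finset.prod_pos
    intro e he
    have := hpt e ((mem_tEdges ends t).1 he)
    linarith
  set Fh : Set V → R := fun W => expect p (fun ω' => F W (merged ends (delConfig ends W ω') t Y X))
    with hFh
  set Gh : Set V → R := fun W => expect p (fun ω' => G W (merged ends (delConfig ends W ω') t Y X))
    with hGh
  have hFm : Monotone Fh := fibreExpect_mono ends t X Y hp hF
  have hGm : Monotone Gh := fibreExpect_mono ends t X Y hp hG
  have hF0' : ∀ W, 0 ≤ Fh W := fun W => expect_nonneg hp fun _ => hF0 _ _
  have hG0' : ∀ W, 0 ≤ Gh W := fun W => expect_nonneg hp fun _ => hG0 _ _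
  have hFM' : ∀ W, Fh W ≤ M := fun W => expect_le_of_le hp fun _ => hFM _ _
  have hGM' : ∀ W, Gh W ≤ M := fun W => expect_le_of_le hp fun _ => hGM _ _
  have key := merged_marginal_pa ends s t X Y hp htY hδ hFm hGm hF0' hG0' hFM' hGM'
  rw [expect_merged_mul_indicator p ends s t X Y F, expect_merged_mul_indicator p ends s t X Y G,
    expect_merged_mul_indicator p ends s t X Y (fun W C => F W C * G W C)]
  have hpt' : ∀ ω, Fh (merged ends ω s X Y) * Gh (merged ends ω s X Y) *
      ({ω : Config E | t ∉ merged ends ω s X Y}).indicator (1 : Config E → R) ω ≤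
      expect p (fun ω' => F (merged ends ω s X Y)
          (merged ends (delConfig ends (merged ends ω s X Y) ω') t Y X) *
        G (merged ends ω s X Y) (merged ends (delConfig ends (merged ends ω s X Y) ω') t Y X)) *
        ({ω : Config E | t ∉ merged ends ω s X Y}).indicator 1 ω := by
    intro ω
    exact mul_le_mul_of_nonneg_right (fibreExpect_mul_le ends t X Y hp hF hG _)
      (Set.indicator_apply_nonneg fun _ => zero_le_one)
  have hmono := expect_mono hp hpt'
  have hQ0 : 0 ≤ prob p {ω : Config E | t ∉ merged ends ω s X Y} := prob_nonneg hp _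
  exact key.trans (mul_le_mul_of_nonneg_right hmono hQ0)

end Main

end MergedU

end Summit.Ventures.PercRepro2
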